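import Mathlib
import Literature.AlgebraicGeometry.HyperbolicPolynomials.SmoothBoundary

/-!
# `PermanentalConeHard` (stmt-ValiantsHypothesis-8654), line `birth` — psd-rank lower-bound toolkit

Route `PermanentalCones` of `ValiantsHypothesis`, crux `PermanentalConeHard` (H+), core stub
`stub_permanentalGradientPsdRank`: for every `m ≤ 2^((log₂ n + c)^c)` the gradient slack matrix
`S[i,k] = gradForm Q_n (z_k) (x_i) = ⟨∇Q_n(z_k), x_i⟩` of the permanental cone `Λ₊(Q_n, 𝟙)` must
admit NO positive-semidefinite factorisation `S[i,k] = tr(U_i V_k)`, `U_i, V_k ∈ 𝕊^m_+` (psd-rank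
`> m`).  This file is the elementary lower-bound toolkit every attack on that stub starts from,
and the formal statement of why the elementary toolkit cannot finish it.

* `PsdRank.mul_eq_zero_of_trace_mul_eq_zero` — **trace orthogonality**: for real psd `U, V`,
  `tr(U V) = 0 → U V = 0` (write `V = Bᵀ B`; `tr(U Bᵀ B) = Σ_i b_iᵀ U b_i` is a sum of
  nonnegative terms, so `U b_i = 0` for every row `b_i` of `B`).
* `PsdRank.linearIndependent_of_triangular` (and the mirrored `…_triangular'`) — the abstract
  **triangular (fooling-set) lemma**: vectors `v_a` and linear functionals `φ_a` with
  `φ_a(v_a) ≠ 0` and `φ_b(v_a) = 0` for `a < b` are linearly independent.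
* `PsdRank.card_le_of_triangular_psd` / `stub_psdRankTriangularBound` — **psd-rank ≥ size of a
  triangular pattern**: if `tr(U_{ρ a} V_{γ a}) ≠ 0` and `tr(U_{ρ a} V_{γ b}) = 0` for `a < b`
  (`a, b < K`) with all `U, V ∈ 𝕊^m_+`, then `K ≤ m`; equivalently a nonnegative matrix with a
  `K × K` triangular pattern with nonzero diagonal has no psd factorisation of size `m < K`
  (the psd analogue of the fooling-set bound for nonnegative rank; e.g. `psd-rank(I_K) = K`).
* `PsdRank.card_le_of_triangular_functionals` / `stub_gradientFoolingPatternLeVars` — **the rank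
  obstruction**: a triangular pattern inside a matrix of the form `L_k(x_i)` (`L_k` linear
  functionals on `ℝⁿ`, in particular the gradient slack matrices `gradForm P (z_k) (x_i)`) has
  size `K ≤ n`, because the pattern forces `x_{ρ 0}, …, x_{ρ (K-1)}` to be linearly independent.
  Consequence for the line: the triangular bound certifies psd-rank `≥ K` only for `K ≤ n`, which
  settles level `c = 0` of the core stub (psd-rank `> 2`) and nothing more — level `c = 1`
  already asks for psd-rank `> 2^(⌊log₂ n⌋ + 1) > n ≥ rank S`, i.e. for a "psd-rank ≫ rank"
  phenomenon, available in print only through the Lee–Raghavendra–Steurer sum-of-squares route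
  for pattern submatrices of 0/1-polytope slack matrices (arXiv:1411.6317, Thm 1.1/5.4).
* `PsdRank.rescale` — psd factorisations are stable under nonnegative row/column rescaling (the
  normalisation step of any embedding argument).

References: Fawzi–Gouveia–Parrilo–Robinson–Thomas, *Positive semidefinite rank*, Math. Program.
153 (2015) §2 (definition, `rank_psd ≥ ·` basics); Lee–Raghavendra–Steurer, arXiv:1411.6317,
Def. 1.7.  Everything here is folklore linear algebra, proved in full.
-/

set_option linter.dupNamespace false

namespace Summit.ValiantsHypothesis.ValiantsHypothesis.Theorems.PermanentalConesPermanentalConeHard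

open Matrix
open scoped MatrixOrder
open Literature.AlgebraicGeometry.HyperbolicPolynomials

namespace PsdRank

variable {m : ℕ}

/-- **Trace orthogonality.** For real positive semidefinite `U, V` of the same size,
`tr(U V) = 0` forces `U V = 0`. [folklore] -/
theorem mul_eq_zero_of_trace_mul_eq_zero {U V : Matrix (Fin m) (Fin m) ℝ}
    (hU : U.PosSemidef) (hV : V.PosSemidef) (h : (U * V).trace = 0) : U * V = 0 := by
  classical
  -- `V = Bᴴ B = Bᵀ B`
  obtain ⟨B, hB⟩ := CStarAlgebra.nonneg_iff_eq_star_mul_self.mp hV.nonneg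
  have hBV : V = Bᵀ * B := by
    rw [hB, Matrix.star_eq_conjTranspose, Matrix.conjTranspose_eq_transpose_of_trivial]
  -- `tr(U V) = Σ_i b_iᵀ U b_i` over the rows `b_i = B i` of `B`
  have hsum : (U * V).trace = ∑ i, B i ⬝ᵥ (U *ᵥ B i) := by
    rw [hBV, ← Matrix.mul_assoc, Matrix.trace_mul_comm]
    simp only [Matrix.trace, Matrix.diag_apply, Matrix.mul_apply, Matrix.transpose_apply,
      dotProduct, Matrix.mulVec, Finset.mul_sum]
  have hnn : ∀ i, 0 ≤ B i ⬝ᵥ (U *ᵥ B i) := fun i => by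
    simpa only [star_trivial] using hU.dotProduct_mulVec_nonneg (B i)
  have hzero : ∀ i, B i ⬝ᵥ (U *ᵥ B i) = 0 := by
    have h0 : ∑ i, B i ⬝ᵥ (U *ᵥ B i) = 0 := by rw [← hsum, h]
    exact fun i => (Finset.sum_eq_zero_iff_of_nonneg fun i _ => hnn i).1 h0 i (Finset.mem_univ i)
  have hker : ∀ i, U *ᵥ B i = 0 := fun i =>
    (hU.dotProduct_mulVec_zero_iff (B i)).1 (by simpa only [star_trivial] using hzero i)
  have hUBt : U * Bᵀ = 0 := by
    ext j i
    have := congrFun (hker i) j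
    simpa only [Matrix.mul_apply, Matrix.transpose_apply, Matrix.mulVec, dotProduct,
      Matrix.zero_apply, Pi.zero_apply] using this
  rw [hBV, ← Matrix.mul_assoc, hUBt, Matrix.zero_mul]

/-- **Triangular (fooling-set) lemma, abstract form.** Vectors `v_a` and linear functionals
`φ_a` (`a < K`) with `φ_a(v_a) ≠ 0` and `φ_b(v_a) = 0` whenever `a < b` make `v` linearly
independent (look at the largest index in a vanishing combination). [folklore] -/
theorem linearIndependent_of_triangular {K : ℕ} {W : Type*} [AddCommGroup W] [Module ℝ W]
    (v : Fin K → W) (φ : Fin K → W →ₗ[ℝ] ℝ) (hdiag : ∀ a, φ a (v a) ≠ 0)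
    (hoff : ∀ a b, a < b → φ b (v a) = 0) : LinearIndependent ℝ v := by
  classical
  rw [Fintype.linearIndependent_iff]
  intro g hg
  by_contra! hne
  obtain ⟨i₀, hi₀⟩ := hne
  set s : Finset (Fin K) := Finset.univ.filter fun a => g a ≠ 0 with hs
  have hsne : s.Nonempty := ⟨i₀, by simp [hs, hi₀]⟩
  set b := s.max' hsne with hb
  have hgb : g b ≠ 0 := by
    have hmem := s.max'_mem hsne
    rw [← hb] at hmem
    simpa [hs] using hmem
  have hgt : ∀ a, b < a → g a = 0 := by
    intro a hba
    by_contra h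
    exact absurd (s.le_max' a (by simp [hs, h])) (not_le.mpr (hb ▸ hba))
  have happ := congrArg (φ b) hg
  rw [map_sum, map_zero, Finset.sum_eq_single b] at happ
  · rw [map_smul, smul_eq_mul] at happ
    exact hgb ((mul_eq_zero.1 happ).resolve_right (hdiag b))
  · intro a _ hab
    rcases lt_or_gt_of_ne hab with h | h
    · rw [map_smul, hoff a b h, smul_zero]
    · rw [hgt a h, zero_smul, map_zero]
  · intro h
    exact absurd (Finset.mem_univ b) h

/-- Mirror form of `linearIndependent_of_triangular`: `φ_a(v_b) = 0` whenever `a < b`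
(reverse the index order). [folklore] -/
theorem linearIndependent_of_triangular' {K : ℕ} {W : Type*} [AddCommGroup W] [Module ℝ W]
    (v : Fin K → W) (φ : Fin K → W →ₗ[ℝ] ℝ) (hdiag : ∀ a, φ a (v a) ≠ 0)
    (hoff : ∀ a b, a < b → φ a (v b) = 0) : LinearIndependent ℝ v := by
  have h := linearIndependent_of_triangular (v ∘ Fin.rev) (φ ∘ Fin.rev) (fun a => hdiag _)
    (fun a b hab => hoff (Fin.rev b) (Fin.rev a) (Fin.rev_lt_rev.mpr hab))
  have hrev : (v ∘ Fin.rev) = v ∘ (Fin.revPerm : Equiv.Perm (Fin K)) := rfl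
  rw [hrev] at h
  exact (linearIndependent_equiv Fin.revPerm).mp h

/-- **Rank obstruction, abstract form.** A triangular pattern `φ_a(x_a) ≠ 0`, `φ_b(x_a) = 0`
(`a < b < K`) among points `x_a ∈ ℝⁿ` and linear functionals `φ_a` on `ℝⁿ` has size `K ≤ n`.
[folklore] -/
theorem card_le_of_triangular_functionals {K n : ℕ} (x : Fin K → (Fin n → ℝ))
    (φ : Fin K → (Fin n → ℝ) →ₗ[ℝ] ℝ) (hdiag : ∀ a, φ a (x a) ≠ 0)
    (hoff : ∀ a b, a < b → φ b (x a) = 0) : K ≤ n := by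
  have h := (linearIndependent_of_triangular x φ hdiag hoff).fintype_card_le_finrank
  simpa using h

/-- **psd-rank ≥ size of a triangular pattern.** If `U_i, V_k ∈ 𝕊^m_+` and along
`ρ, γ : Fin K → ·` one has `tr(U_{ρ a} V_{γ a}) ≠ 0` and `tr(U_{ρ a} V_{γ b}) = 0` for `a < b`,
then `K ≤ m`: by trace orthogonality `U_{ρ a} V_{γ b} = 0` for `a < b`, so a nonzero entry
`(U_{ρ a} V_{γ a})_{i_a j_a}` yields functionals `y ↦ (U_{ρ a} y)_{i_a}` and vectors
`(V_{γ a})_{· j_a}` in triangular position in `ℝᵐ`. [folklore] -/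
theorem card_le_of_triangular_psd {K : ℕ} {ι κ : Type*} (U : ι → Matrix (Fin m) (Fin m) ℝ)
    (V : κ → Matrix (Fin m) (Fin m) ℝ) (hU : ∀ i, (U i).PosSemidef) (hV : ∀ k, (V k).PosSemidef)
    (ρ : Fin K → ι) (γ : Fin K → κ) (hdiag : ∀ a, (U (ρ a) * V (γ a)).trace ≠ 0)
    (hoff : ∀ a b, a < b → (U (ρ a) * V (γ b)).trace = 0) : K ≤ m := by
  classical
  have horth : ∀ a b, a < b → U (ρ a) * V (γ b) = 0 := fun a b h =>
    mul_eq_zero_of_trace_mul_eq_zero (hU _) (hV _) (hoff a b h)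
  have hex : ∀ a, ∃ ij : Fin m × Fin m, (U (ρ a) * V (γ a)) ij.1 ij.2 ≠ 0 := by
    intro a
    by_contra! h
    refine hdiag a ?_
    have h0 : U (ρ a) * V (γ a) = 0 := Matrix.ext fun i j => h ⟨i, j⟩
    rw [h0, Matrix.trace_zero]
  choose ij hij using hex
  let v : Fin K → (Fin m → ℝ) := fun a k => V (γ a) k (ij a).2
  let φ : Fin K → (Fin m → ℝ) →ₗ[ℝ] ℝ := fun a =>
    (LinearMap.proj (ij a).1).comp (Matrix.mulVecLin (U (ρ a)))
  have hφ : ∀ a b, φ a (v b) = (U (ρ a) * V (γ b)) (ij a).1 (ij b).2 := by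
    intro a b
    simp [φ, v, Matrix.mul_apply, Matrix.mulVec, dotProduct]
  have hli := linearIndependent_of_triangular' v φ (fun a => by rw [hφ]; exact hij a)
    (fun a b hab => by rw [hφ, horth a b hab]; rfl)
  simpa using hli.fintype_card_le_finrank

/-- **Rescaling.** A psd factorisation of `M` gives one (of the same size) of the rescaled
matrix `c_i · M i k · d_k` for nonnegative weights `c, d`. [folklore] -/
theorem rescale {ι κ : Type*} {M : ι → κ → ℝ} {U : ι → Matrix (Fin m) (Fin m) ℝ}
    {V : κ → Matrix (Fin m) (Fin m) ℝ} (hU : ∀ i, (U i).PosSemidef) (hV : ∀ k, (V k).PosSemidef)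
    (hM : ∀ i k, M i k = (U i * V k).trace) {c : ι → ℝ} {d : κ → ℝ} (hc : ∀ i, 0 ≤ c i)
    (hd : ∀ k, 0 ≤ d k) :
    (∀ i, (c i • U i).PosSemidef) ∧ (∀ k, (d k • V k).PosSemidef) ∧
      ∀ i k, c i * M i k * d k = ((c i • U i) * (d k • V k)).trace := by
  refine ⟨fun i => (hU i).smul (hc i), fun k => (hV k).smul (hd k), fun i k => ?_⟩
  rw [Matrix.smul_mul, Matrix.mul_smul, Matrix.trace_smul, Matrix.trace_smul, hM, smul_eq_mul,
    smul_eq_mul]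
  ring

end PsdRank

/-- Registered form (`stub_psdRankTriangularBound`, infrastructure stub of the core
`stub_permanentalGradientPsdRank`, in the shape of that stub's `¬ ∃ U V …` clause): a real matrix
`M` containing a `K × K` triangular pattern with nonzero diagonal (`M (ρ a) (γ a) ≠ 0`,
`M (ρ a) (γ b) = 0` for `a < b`) admits no positive-semidefinite factorisation of size `m < K`.
[folklore] -/
theorem stub_psdRankTriangularBound :
    ∀ (ι κ : Type) (m K : ℕ) (M : ι → κ → ℝ) (ρ : Fin K → ι) (γ : Fin K → κ),
      (∀ a, M (ρ a) (γ a) ≠ 0) → (∀ a b, a < b → M (ρ a) (γ b) = 0) → m < K →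
      ¬ ∃ (U : ι → Matrix (Fin m) (Fin m) ℝ) (V : κ → Matrix (Fin m) (Fin m) ℝ),
          (∀ i, (U i).PosSemidef) ∧ (∀ k, (V k).PosSemidef) ∧
          ∀ i k, M i k = Matrix.trace (U i * V k) := by
  rintro ι κ m K M ρ γ hdiag hoff hmK ⟨U, V, hU, hV, hM⟩
  have hK : K ≤ m := PsdRank.card_le_of_triangular_psd U V hU hV ρ γ
    (fun a => by rw [← hM]; exact hdiag a) (fun a b h => by rw [← hM]; exact hoff a b h)
  omega

/-- Registered form (`stub_gradientFoolingPatternLeVars`, infrastructure stub of the core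
`stub_permanentalGradientPsdRank`): **the rank obstruction** — a triangular pattern inside a
gradient slack matrix `gradForm P (zs k) (xs i) = ⟨∇P(zs k), xs i⟩` of ANY polynomial `P` in `n`
variables has size `K ≤ n` (the points `xs (ρ a)` are forced to be linearly independent in `ℝⁿ`).
Hence the triangular bound `stub_psdRankTriangularBound` can certify psd-rank `≥ K` for the
matrices of the core stub only when `K ≤ n`: it settles level `c = 0` (`m ≤ 2`) and is void from
level `c = 1` on (`m = 2^(⌊log₂ n⌋ + 1) > n`). [folklore] -/
theorem stub_gradientFoolingPatternLeVars :
    ∀ (n K : ℕ) (P : MvPolynomial (Fin n) ℝ) (ι κ : Type) (xs : ι → Fin n → ℝ)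
      (zs : κ → Fin n → ℝ) (ρ : Fin K → ι) (γ : Fin K → κ),
      (∀ a, gradForm P (zs (γ a)) (xs (ρ a)) ≠ 0) →
      (∀ a b, a < b → gradForm P (zs (γ b)) (xs (ρ a)) = 0) → K ≤ n := by
  intro n K P ι κ xs zs ρ γ hdiag hoff
  exact PsdRank.card_le_of_triangular_functionals (fun a => xs (ρ a))
    (fun a => gradForm P (zs (γ a))) hdiag hoff

end Summit.ValiantsHypothesis.ValiantsHypothesis.Theorems.PermanentalConesPermanentalConeHard
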